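/-
Copyright (c) 2026 the pub-hodgecm-mathlib formalisation cell (harness21).  Prover seat hodgecm-mathlib-F0P2-p10 (g0) (re-dealt to strike line L1 by
director s1969 (b) ∕ s1970, LEAD F0P6-plan (g14) EMIT #1 «p21 file»), Track B «K2-LIT», #184♮ = hLiu418 = `stmt-HodgeConjecture-24832`;
Road I v3, S5-F3 lineage ∕ I4-conv (F′-fact), FILE C part 2: at a good place the LOCAL inner section of term 2 IS `c_v · Λ^{line}_{σ,v} ∘ Ψ_{S,v}`.
-/
import Summits.HodgeConjecture.HodgeConjecture.Theorems.K2LiuLineBridgeLocalDictionary       -- FILE C part 1: the local line-bridge dictionary (`κ`, `hκ`), `localCongr_apply_eq_conj`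
import Summits.HodgeConjecture.HodgeConjecture.Theorems.K2LiuSphericalSectionLambdaLoc       -- ★ (4c): `eq_lambdaLoc_of_isSphericalSection`, `exists_isSiegelIntDecomp` (+ ★ D7c `LambdaLoc`, ★ D10)
import HarnessLib

/-!
# Crux `HLiu418`, Road I v3, I4-conv (F′-fact), FILE C part 2 — `K2LiuKlingenInnerSectionSpherical`:
# AT A GOOD PLACE THE LOCAL INNER SECTION OF TERM 2 IS `J_v = c_v · Λ^{line}_{σ,v} ∘ Ψ_{S,v}`, `c_v = J_v(1)`

Cell `hodgecm-mathlib`, crux item hLiu418 = `stmt-HodgeConjecture-24832`; squad K2 ∕ K2Liu; LEAD F0P6-plan (g14) EMIT #1 (2026-09-04T14:48:16Z, «p21 file»: «local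
law + right-`K` ⇒ `J_v = c_v(s)·Λ^{line}∘Ψ_{S,v}` via ★ `eq_lambdaLoc_of_isSphericalSection`; p14's B heads BY VALUE»), director s1970 «p10 → the p21 file»;
spec = K2Liu-p14 (g3) census `K2/K2Liu-p14/g3/CENSUS-I4conv-FprimeFact.K2Liu-p14-g3.md` 889e5ba8cd056cf7 §2 FILE C; prover F0P2-p10 (g0).
THEOREMS ONLY (no `def`, no instance, no notation, no named-fact hypothesis, no `sorry`); lane `--supports stmt-HodgeConjecture-24832 --as helper` (count-neutral).

THE POINT.  In the Euler factorisation of the inner section `F′_{h,f_s}` of term 2 of the Klingen constant term (★ F8 ∕ ★ F10 ∕ ★ carrier (A)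
`K2LiuKlingenTermTwoTransport`, FILE D ★ `K2LiuKlingenInnerSectionEuler`, FILE E to come) the factor at a GOOD finite place `v` of `L⁺` (`|2|_w = 1`, `χ`
unramified at every `w ∣ v`) is a functional `J_v` on the LINE group `U(J)(L⁺_v)` (tree type `UnitaryGroup.localPi L c 2 J v`) which — FILE B, BY VALUE here:
binders `hlaw`, `hK` — has the local Borel law in entries at the E1 parameter `σ = s − ½` and is right-`U(J)(𝒪_v)`-invariant.  This file proves
`J_v = J_v(1) · Λ^{line}_{σ,v} ∘ Ψ_{S,v}`, with `Λ^{line}_{σ,v}` ★ D7c `LambdaLoc` of the doubled line `H₁ = U(𝕍₁ ⊕ −𝕍₁)`, `𝕍₁ = (L, 1)`, and `Ψ_{S,v}` the place-`v`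
line bridge of FILE C part 1 `K2LiuLineBridgeLocalDictionary` (BY VALUE as `κ`, `hκ`; ★ «D5» `UnitaryGroup.localCongr … S … v` is the bridge of record, §5).
* §1 (generic `n`) **`apply_eq_apply_one_mul_lambdaLoc`** — at a good place EVERY `φ : H(L⁺_v) → ℂ` with the local Siegel law (★ D1 `IsLocalSiegelSection`) and
  right-`K_{H,v}`-invariance is `φ(1) · Λ_{s,v}`: the UNNORMALISED twin of ★ (4c) `eq_lambdaLoc_of_isSphericalSection` (no `φ(1) = 1`, no junk value).
* §4 THE HEADS: `isLocalSiegelSection_comp_symm` (`J_v ∘ κ⁻¹` is a Siegel section of `I_v(σ, χ_v)` — place-`v` twin of ★ `isSiegelDeltaSection_comp_bridge_symm`),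
  `comp_symm_mul_localInt` (it is right-`K_{H₁,v}`-invariant), `valuation_gramR_one_le` (the `n = 1` frame's integrality binders are vacuous: `gramR = 1`),
  **`apply_symm_eq_apply_one_mul_lambdaLoc`** — `∀ h, J_v(κ⁻¹ h) = J_v(1) · Λ^{line}_{σ,v}(h)` under `h2` + `hχ` ONLY — the doubled-line form FILE E reads on its
  factorizable family (★ #31s `IsFactorizableOff`: `Λ^{line}` BY VALUE at the good places, `c_v = J_v(1)` absorbed in the `T′`-part);
  **`apply_eq_apply_one_mul_lambdaLoc_apply`** (`∀ x, J_v(x) = J_v(1) · Λ^{line}_{σ,v}(κ x)`); `comp_symm_eq_lambdaLoc` (normalised form `J_v(1) = 1`: `J_v ∘ κ⁻¹`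
  IS ★ D10's spherical section and equals `Λ^{line}_{σ,v}`, literally via ★ `eq_lambdaLoc_of_isSphericalSection`).
* §5 **`apply_eq_apply_one_mul_lambdaLoc_localCongr`** — the head at the bridge of record `Ψ_{S,v} = ★ localCongr … S … v`: the census's
  `J_v = c_v · Λ^{line}_{σ,v} ∘ Ψ_{S,v}`, `c_v = J_v(1)` (its VALUE, an `L`-factor ratio, is not needed for factorisability and is not computed).
[Casselman1980, §3], [Li1992, §3], [Tan1999, §1], [MoeglinWaldspurger1995, I.1.4, II.1.7], [PlatonovRapinchuk1994, §2.3, §5.1], [HarrisKudlaSweet1996, §1 (1.15), §6 (6.14)].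
HONEST LABEL.  Count-neutral helper: `HC_CM` is proved only modulo the 7 printed citations (2 remaining named inputs: hLiu418 = `stmt-HodgeConjecture-24832`,
h413 = `stmt-HodgeConjecture-24833`) until rung 0 closes.
-/

set_option autoImplicit false
set_option linter.dupNamespace false -- the mandated namespace repeats `HodgeConjecture.HodgeConjecture`

noncomputable section

open scoped Matrix
open NumberField IsDedekindDomain
open Literature.NumberTheory.Automorphic Literature.NumberTheory.Automorphic.UnitaryGroup
open Literature.NumberTheory.GaloisRepresentations
open Literature.NumberTheory.GelbartRogawski1991 Literature.NumberTheory.GelbartRogawski1991.GRConstruction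
open Literature.NumberTheory.GelbartRogawski1991.UnitaryDualPair
open Literature.NumberTheory.K2Lit.SiegelDoubled Literature.NumberTheory.K2Lit.LocalSiegelDoubled
open Summit.HodgeConjecture.HodgeConjecture.Cruxes.HLiu418.K2LiuSphericalSectionLambdaLoc (exists_isSiegelIntDecomp eq_lambdaLoc_of_isSphericalSection)
open Summit.HodgeConjecture.HodgeConjecture.Cruxes.H413.K2E1BorelEisensteinU2FromK2Liu (gramR_one)
open Summit.HodgeConjecture.HodgeConjecture.Cruxes.HLiu418.K2LiuLineBridgeLocalDictionary

namespace Summit.HodgeConjecture.HodgeConjecture.Cruxes.HLiu418.K2LiuKlingenInnerSectionSpherical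

/-! ## §1 At a good place a right-`K_{H,v}`-invariant Siegel section is `φ(1) · Λ_{s,v}` (generic `n`) -/

section GoodPlace

variable (L : Type) [Field L] [NumberField L] [IsCMField L]
variable {N M n : ℕ} (e : Fin N × Fin M ≃ Fin n)
  (dV : Fin N → L) (hdV : ∀ i, IsCMField.complexConj L (dV i) = dV i)
  (dW : Fin M → L) (hdW : ∀ i, IsCMField.complexConj L (dW i) = dW i)
  (v : HeightOneSpectrum (𝓞 (Fp L)))
  (hdV0 : ∀ i, dV i ≠ 0) (hdW0 : ∀ i, dW i ≠ 0)

include hdV0 hdW0 in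
/-- **UNNORMALISED SPHERICAL UNIQUENESS.**  At a good place (`|2|_w = 1`, `gramR`, `gramR⁻¹` integral at every `w ∣ v`) and for `χ` unramified above `v`:
every `φ : H(L⁺_v) → ℂ` with the local Siegel law `φ(p h) = χ_v(det_Δ p)|det_Δ p|_v^{s+n/2} φ(h)` (★ D1 `IsLocalSiegelSection`) which is right-invariant under
`K_{H,v} = H(𝒪_v)` satisfies `φ(h) = φ(1) · Λ_{s,v}(h)` — every `h` is `p k` (★ `exists_isSiegelIntDecomp`), `φ(p k) = χ_v s(p) φ(1)` and
`Λ_{s,v}(p k) = χ_v s(p)` (★ `lambdaLoc_mul_eq`, ★ `siegelCharLoc_eq_localSiegelCharacter_of_mem`).  No normalisation `φ(1) = 1` and no junk value.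
[cite: Casselman1980, §3] [cite: Li1992, §3] [cite: HarrisKudlaSweet1996, §1 (1.15)] -/
theorem apply_eq_apply_one_mul_lambdaLoc (χ : HeckeCharacter L) (s : ℂ) (hχ : ∀ w : UnitaryGroup.PlacesOver L v, χ.IsUnramifiedAt w.1)
    (h2 : ∀ w : UnitaryGroup.PlacesOver L v, ValuativeRel.valuation (w.1.adicCompletion L) (2 : w.1.adicCompletion L) = 1)
    (hT : ∀ (w : UnitaryGroup.PlacesOver L v) (i j : Fin n), ValuativeRel.valuation (w.1.adicCompletion L)
      (algebraMap L (w.1.adicCompletion L) (algebraMap (Fp L) L (gramR L e dV hdV dW hdW i j))) ≤ 1)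
    (hTinv : ∀ (w : UnitaryGroup.PlacesOver L v) (i j : Fin n), ValuativeRel.valuation (w.1.adicCompletion L)
      (algebraMap L (w.1.adicCompletion L) (algebraMap (Fp L) L ((gramR L e dV hdV dW hdW)⁻¹ i j))) ≤ 1)
    {φ : UnitaryGroup.localPi L (IsCMField.complexConj L) (n + n) (hermD L e dV hdV dW hdW) v → ℂ}
    (hφP : haveI : Algebra.IsQuadraticExtension (Fp L) L := IsCMField.isQuadraticExtension L
      IsLocalSiegelSection (Fp L) L (IsCMField.complexConj L) (complexConj_imagUnit L) (imagUnit_ne_zero L) (imagUnit_mul_self L) v n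
        (gramR_isSymm L e dV hdV dW hdW) (hermD_eq_map_gramD L e dV hdV dW hdW) (fun w => χ.localComponent w.1) s φ)
    (hφK : ∀ k ∈ UnitaryGroup.localInt L (IsCMField.complexConj L) (n + n) (hermD L e dV hdV dW hdW) v,
      ∀ h : UnitaryGroup.localPi L (IsCMField.complexConj L) (n + n) (hermD L e dV hdV dW hdW) v, φ (h * k) = φ h)
    (h : UnitaryGroup.localPi L (IsCMField.complexConj L) (n + n) (hermD L e dV hdV dW hdW) v) :
    φ h = φ 1 * LambdaLoc L e dV hdV dW hdW v χ s h := by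
  haveI : Algebra.IsQuadraticExtension (Fp L) L := IsCMField.isQuadraticExtension L
  obtain ⟨⟨p, k⟩, hp, hk, rfl⟩ := exists_isSiegelIntDecomp L e dV hdV dW hdW v hdV0 hdW0 h2 hT hTinv h
  have hp' := (mem_siegelDeltaLoc_iff_local L e dV hdV dW hdW v p).1 hp
  have hk1 : φ k = φ 1 := by simpa only [one_mul] using hφK k hk 1
  rw [hφP p hp' k, hk1, lambdaLoc_mul_eq L e dV hdV dW hdW v χ s hχ hp hk,
    siegelCharLoc_eq_localSiegelCharacter_of_mem L e dV hdV dW hdW v χ s hp, mul_comm]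

end GoodPlace

/-! ## §4 The heads: a right-`U(J)(𝒪_v)`-invariant local Borel section at a good place is `J_v(1) · Λ^{line}_{σ,v} ∘ κ` -/

section Head

variable (L : Type) [Field L] [NumberField L] [IsCMField L] (v : HeightOneSpectrum (𝓞 (Fp L)))
  (S : GL (Fin 2) L) (hS : (S : Matrix (Fin 2) (Fin 2) L) = !![1, 2⁻¹; 1, -2⁻¹])
  (hS' : ((S⁻¹ : GL (Fin 2) L) : Matrix (Fin 2) (Fin 2) L) = !![2⁻¹, 2⁻¹; 1, -1])
  {J : Matrix (Fin 2) (Fin 2) L}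
  (κ : UnitaryGroup.localPi L (IsCMField.complexConj L) 2 J v ≃ₜ* UnitaryGroup.localPi L (IsCMField.complexConj L) (1 + 1)
      (hermD L (Equiv.prodUnique (Fin 1) (Fin 1)) (fun _ => (1 : L)) (fun _ => map_one _) (fun _ => (1 : L)) (fun _ => map_one _)) v)
  (hκ : ∀ (x : UnitaryGroup.localPi L (IsCMField.complexConj L) 2 J v) (w : UnitaryGroup.PlacesOver L v),
    (κ x : UnitaryGroup.LocalGLPi L (1 + 1) v) w =
      Matrix.GeneralLinearGroup.map (algebraMap L (w.1.adicCompletion L)) S * (x : UnitaryGroup.LocalGLPi L 2 v) w *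
        (Matrix.GeneralLinearGroup.map (algebraMap L (w.1.adicCompletion L)) S)⁻¹)
  (χ : HeckeCharacter L) (σ : ℂ) {Jv : UnitaryGroup.localPi L (IsCMField.complexConj L) 2 J v → ℂ}
  (hlaw : ∀ (b g : UnitaryGroup.localPi L (IsCMField.complexConj L) 2 J v) (u : ∀ w : UnitaryGroup.PlacesOver L v, (w.1.adicCompletion L)ˣ),
    (∀ w : UnitaryGroup.PlacesOver L v,
      (((b : UnitaryGroup.LocalGLPi L 2 v) w : GL (Fin 2) (w.1.adicCompletion L)) : Matrix (Fin 2) (Fin 2) (w.1.adicCompletion L)) 1 0 = 0) →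
    (∀ w : UnitaryGroup.PlacesOver L v, (u w : w.1.adicCompletion L) =
      (((b : UnitaryGroup.LocalGLPi L 2 v) w : GL (Fin 2) (w.1.adicCompletion L)) : Matrix (Fin 2) (Fin 2) (w.1.adicCompletion L)) 0 0) →
      Jv (b * g) = (∏ w : UnitaryGroup.PlacesOver L v, ((χ.localComponent w.1 (u w) : ℂˣ) : ℂ)) *
        (((∏ w : UnitaryGroup.PlacesOver L v, ‖(u w : w.1.adicCompletion L)‖ : ℝ) : ℂ) ^ (σ + 1 / 2)) * Jv g)
  (hK : ∀ k ∈ UnitaryGroup.localInt L (IsCMField.complexConj L) 2 J v, ∀ g : UnitaryGroup.localPi L (IsCMField.complexConj L) 2 J v, Jv (g * k) = Jv g)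
  (hχ : ∀ w : UnitaryGroup.PlacesOver L v, χ.IsUnramifiedAt w.1)
  (h2 : ∀ w : UnitaryGroup.PlacesOver L v, ValuativeRel.valuation (w.1.adicCompletion L) (2 : w.1.adicCompletion L) = 1)

-- Budget note: ★ D1's binders spell the base field `Fp L` while the tree's `localPi`∕`κ` currency elaborates it as `↥(maximalRealSubfield L)` (reducibly
-- equal); the products met through `intro` are unified across the two spellings — correct but slow, hence the raised cap (as ★ D7c `lambdaLoc_mem_localDegPS`).
set_option maxHeartbeats 400000 in
include hS hS' hκ hlaw in
/-- **`J_v ∘ κ⁻¹` IS A SIEGEL SECTION OF `I_v(σ, χ_v)` OF THE DOUBLED LINE** whenever `J_v` has the local Borel law in entries (`hlaw`: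
`J_v(b g) = ∏_w χ_w(u_w) · (∏_w ‖u_w‖_w)^{σ+½} · J_v(g)` for `(b_w)₁₀ = 0`, `u_w = (b_w)₀₀`) — the place-`v` twin of ★ `isSiegelDeltaSection_comp_bridge_symm`
(§3 `mem_siegelDeltaLoc_iff_symm_apply`, `isUnit_apply_zero_zero_of_apply_one_zero`, `localSiegelCharacter_eq_of_symm_apply`). [cite: Tan1999, §1]
[cite: MoeglinWaldspurger1995, I.1.4] [cite: HarrisKudlaSweet1996, §1 (1.15)] -/
theorem isLocalSiegelSection_comp_symm :
    haveI : Algebra.IsQuadraticExtension (Fp L) L := IsCMField.isQuadraticExtension L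
    IsLocalSiegelSection (Fp L) L (IsCMField.complexConj L) (complexConj_imagUnit L) (imagUnit_ne_zero L) (imagUnit_mul_self L) v 1
      (gramR_isSymm L (Equiv.prodUnique (Fin 1) (Fin 1)) (fun _ => (1 : L)) (fun _ => map_one _) (fun _ => (1 : L)) (fun _ => map_one _))
      (hermD_eq_map_gramD L (Equiv.prodUnique (Fin 1) (Fin 1)) (fun _ => (1 : L)) (fun _ => map_one _) (fun _ => (1 : L)) (fun _ => map_one _))
      (fun w => χ.localComponent w.1) σ (fun h => Jv (κ.symm h)) := by
  haveI : Algebra.IsQuadraticExtension (Fp L) L := IsCMField.isQuadraticExtension L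
  intro p hp h
  have hb10 := (mem_siegelDeltaLoc_iff_symm_apply L v S hS hS' κ hκ p).1
    ((mem_siegelDeltaLoc_iff_local L (Equiv.prodUnique (Fin 1) (Fin 1)) (fun _ => (1 : L)) (fun _ => map_one _) (fun _ => (1 : L))
      (fun _ => map_one _) v p).2 hp)
  have hbu : ∀ w : UnitaryGroup.PlacesOver L v,
      IsUnit ((((κ.symm p : UnitaryGroup.LocalGLPi L 2 v) w : GL (Fin 2) (w.1.adicCompletion L)) : Matrix (Fin 2) (Fin 2) (w.1.adicCompletion L)) 0 0) :=
    fun w => isUnit_apply_zero_zero_of_apply_one_zero _ (hb10 w)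
  have hu : ∀ w : UnitaryGroup.PlacesOver L v, ((hbu w).unit : w.1.adicCompletion L) =
      (((κ.symm p : UnitaryGroup.LocalGLPi L 2 v) w : GL (Fin 2) (w.1.adicCompletion L)) : Matrix (Fin 2) (Fin 2) (w.1.adicCompletion L)) 0 0 :=
    fun w => (hbu w).unit_spec
  have key := hlaw (κ.symm p) (κ.symm h) (fun w => (hbu w).unit) hb10 hu
  have hmul : κ.symm (p * h) = κ.symm p * κ.symm h := map_mul κ.symm p h
  have hsc := localSiegelCharacter_eq_of_symm_apply L v S hS hS' κ hκ χ σ p (fun w => (hbu w).unit) hb10 hu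
  refine (congrArg Jv hmul).trans (key.trans ?_)
  rw [hsc]

include hS hS' hκ hK h2 in
/-- **`J_v ∘ κ⁻¹` IS RIGHT-`K_{H₁,v}`-INVARIANT** when `J_v` is right-`U(J)(𝒪_v)`-invariant (`hK`) and `|2|_w = 1` for all `w ∣ v` (§3 `symm_apply_mem_localInt_iff`).
[cite: PlatonovRapinchuk1994, §5.1] [cite: Casselman1980, §3] -/
theorem comp_symm_mul_localInt (k : UnitaryGroup.localPi L (IsCMField.complexConj L) (1 + 1)
      (hermD L (Equiv.prodUnique (Fin 1) (Fin 1)) (fun _ => (1 : L)) (fun _ => map_one _) (fun _ => (1 : L)) (fun _ => map_one _)) v) (hk : k ∈ UnitaryGroup.localInt L (IsCMField.complexConj L) (1 + 1) (hermD L (Equiv.prodUnique (Fin 1) (Fin 1)) (fun _ => (1 : L)) (fun _ => map_one _) (fun _ => (1 : L)) (fun _ => map_one _)) v) (h : UnitaryGroup.localPi L (IsCMField.complexConj L) (1 + 1)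
      (hermD L (Equiv.prodUnique (Fin 1) (Fin 1)) (fun _ => (1 : L)) (fun _ => map_one _) (fun _ => (1 : L)) (fun _ => map_one _)) v) :
    Jv (κ.symm (h * k)) = Jv (κ.symm h) := by
  rw [map_mul]
  exact hK _ ((symm_apply_mem_localInt_iff L v S hS hS' κ hκ k h2).2 hk) _

/-- `gramR = 1` for the hermitian line: the good-place integrality binders `hT`, `hTinv` of ★ (4b)∕(4c) are VACUOUS at `n = 1` (★ `gramR_one`). [folklore] -/
theorem valuation_gramR_one_le (w : UnitaryGroup.PlacesOver L v) (i j : Fin 1) :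
    ValuativeRel.valuation (w.1.adicCompletion L) (algebraMap L (w.1.adicCompletion L) (algebraMap (Fp L) L
        (gramR L (Equiv.prodUnique (Fin 1) (Fin 1)) (fun _ => (1 : L)) (fun _ => map_one _) (fun _ => (1 : L)) (fun _ => map_one _) i j))) ≤ 1 ∧
      ValuativeRel.valuation (w.1.adicCompletion L) (algebraMap L (w.1.adicCompletion L) (algebraMap (Fp L) L
        ((gramR L (Equiv.prodUnique (Fin 1) (Fin 1)) (fun _ => (1 : L)) (fun _ => map_one _) (fun _ => (1 : L)) (fun _ => map_one _))⁻¹ i j))) ≤ 1 := by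
  have hij : j = i := Subsingleton.elim _ _
  subst hij
  rw [gramR_one, inv_one, Matrix.one_apply_eq, map_one, map_one, map_one]
  exact ⟨le_rfl, le_rfl⟩

include hS hS' hκ hlaw hK hχ h2 in
/-- **THE HEAD (doubled-line side).  AT A GOOD PLACE `J_v ∘ κ⁻¹ = J_v(1) · Λ^{line}_{σ,v}`.**  Let `v` be a finite place of `L⁺` with `|2|_w = 1` (`h2`) and `χ`
unramified at every `w ∣ v` (`hχ`), `κ : U(J)(L⁺_v) ≃ₜ* H₁(L⁺_v)` the conjugation by `S` (`hκ`), and let `J_v : U(J)(L⁺_v) → ℂ` satisfy the local Borel law in entries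
at the parameter `σ` (`hlaw`) and right-`U(J)(𝒪_v)`-invariance (`hK`).  Then `J_v(κ⁻¹ h) = J_v(1) · Λ_{σ,v}(h)` for every `h ∈ H₁(L⁺_v)`: `J_v ∘ κ⁻¹` is a
right-`K_{H₁,v}`-invariant Siegel section (the two heads above), hence `J_v(1) · Λ_{σ,v}` by §1 at the `n = 1` frame, whose integrality binders are vacuous
(`valuation_gramR_one_le`).  This is the doubled-line form FILE E reads on its factorizable family (★ #31s `IsFactorizableOff`); `σ := s − ½`, `c_v(s) := J_v(1)`.
[cite: Casselman1980, §3] [cite: Li1992, §3] [cite: Tan1999, §1] [cite: MoeglinWaldspurger1995, II.1.7] -/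
theorem apply_symm_eq_apply_one_mul_lambdaLoc (h : UnitaryGroup.localPi L (IsCMField.complexConj L) (1 + 1)
      (hermD L (Equiv.prodUnique (Fin 1) (Fin 1)) (fun _ => (1 : L)) (fun _ => map_one _) (fun _ => (1 : L)) (fun _ => map_one _)) v) :
    Jv (κ.symm h) = Jv 1 * LambdaLoc L (Equiv.prodUnique (Fin 1) (Fin 1)) (fun _ => (1 : L)) (fun _ => map_one _) (fun _ => (1 : L)) (fun _ => map_one _) v χ σ h := by
  have key := apply_eq_apply_one_mul_lambdaLoc L (Equiv.prodUnique (Fin 1) (Fin 1)) (fun _ => (1 : L)) (fun _ => map_one _) (fun _ => (1 : L))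
    (fun _ => map_one _) v (fun _ => one_ne_zero) (fun _ => one_ne_zero) χ σ hχ h2 (fun w i j => (valuation_gramR_one_le L v w i j).1)
    (fun w i j => (valuation_gramR_one_le L v w i j).2) (isLocalSiegelSection_comp_symm L v S hS hS' κ hκ χ σ hlaw)
    (fun k hk h => comp_symm_mul_localInt L v S hS hS' κ hκ hK h2 k hk h) h
  rw [map_one] at key
  exact key

include hS hS' hκ hlaw hK hχ h2 in
/-- **THE HEAD (`U(J)` side): `J_v = J_v(1) · Λ^{line}_{σ,v} ∘ κ`** — for every `x ∈ U(J)(L⁺_v)`, `J_v(x) = J_v(1) · Λ_{σ,v}(κ x)`, i.e. the census's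
`J_v = c_v · Λ^{line}_{σ,v} ∘ Ψ_{S,v}`, `c_v = J_v(1)`. [cite: Casselman1980, §3] [cite: Tan1999, §1] [cite: MoeglinWaldspurger1995, II.1.7] -/
theorem apply_eq_apply_one_mul_lambdaLoc_apply (x : UnitaryGroup.localPi L (IsCMField.complexConj L) 2 J v) :
    Jv x = Jv 1 * LambdaLoc L (Equiv.prodUnique (Fin 1) (Fin 1)) (fun _ => (1 : L)) (fun _ => map_one _) (fun _ => (1 : L)) (fun _ => map_one _) v χ σ (κ x) := by
  have key := apply_symm_eq_apply_one_mul_lambdaLoc L v S hS hS' κ hκ χ σ hlaw hK hχ h2 (κ x)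
  rw [ContinuousMulEquiv.symm_apply_apply] at key
  exact key

set_option maxHeartbeats 400000 in
include hS hS' hκ hlaw hK hχ h2 in
/-- **Normalised form: `J_v ∘ κ⁻¹` is THE spherical section of `I_v(σ, χ_v)`** when moreover `J_v(1) = 1` (★ D10 `IsSphericalSection`), and then — via ★ (4c)
`eq_lambdaLoc_of_isSphericalSection` literally — `J_v ∘ κ⁻¹ = Λ^{line}_{σ,v}`. [cite: Casselman1980, §3] [cite: HarrisKudlaSweet1996, §6 (6.14)] [cite: Li1992, §3] -/
theorem comp_symm_eq_lambdaLoc (h1 : Jv 1 = 1) :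
    haveI : Algebra.IsQuadraticExtension (Fp L) L := IsCMField.isQuadraticExtension L
    IsSphericalSection (Fp L) L (IsCMField.complexConj L) (complexConj_imagUnit L) (imagUnit_ne_zero L) (imagUnit_mul_self L) v 1
        (gramR_isSymm L (Equiv.prodUnique (Fin 1) (Fin 1)) (fun _ => (1 : L)) (fun _ => map_one _) (fun _ => (1 : L)) (fun _ => map_one _))
        (hermD_eq_map_gramD L (Equiv.prodUnique (Fin 1) (Fin 1)) (fun _ => (1 : L)) (fun _ => map_one _) (fun _ => (1 : L)) (fun _ => map_one _))
        (fun w => χ.localComponent w.1) σ (fun h => Jv (κ.symm h)) ∧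
      (fun h => Jv (κ.symm h)) =
        LambdaLoc L (Equiv.prodUnique (Fin 1) (Fin 1)) (fun _ => (1 : L)) (fun _ => map_one _) (fun _ => (1 : L)) (fun _ => map_one _) v χ σ := by
  haveI : Algebra.IsQuadraticExtension (Fp L) L := IsCMField.isQuadraticExtension L
  have hsph : IsSphericalSection (Fp L) L (IsCMField.complexConj L) (complexConj_imagUnit L) (imagUnit_ne_zero L) (imagUnit_mul_self L) v 1
      (gramR_isSymm L (Equiv.prodUnique (Fin 1) (Fin 1)) (fun _ => (1 : L)) (fun _ => map_one _) (fun _ => (1 : L)) (fun _ => map_one _))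
      (hermD_eq_map_gramD L (Equiv.prodUnique (Fin 1) (Fin 1)) (fun _ => (1 : L)) (fun _ => map_one _) (fun _ => (1 : L)) (fun _ => map_one _))
      (fun w => χ.localComponent w.1) σ (fun h => Jv (κ.symm h)) :=
    ⟨isLocalSiegelSection_comp_symm L v S hS hS' κ hκ χ σ hlaw, fun k hk h => comp_symm_mul_localInt L v S hS hS' κ hκ hK h2 k hk h,
      show Jv (κ.symm 1) = 1 by rw [map_one, h1]⟩
  exact ⟨hsph, eq_lambdaLoc_of_isSphericalSection L (Equiv.prodUnique (Fin 1) (Fin 1)) (fun _ => (1 : L)) (fun _ => map_one _) (fun _ => (1 : L))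
    (fun _ => map_one _) v (fun _ => one_ne_zero) (fun _ => one_ne_zero) χ σ hχ h2 (fun w i j => (valuation_gramR_one_le L v w i j).1)
    (fun w i j => (valuation_gramR_one_le L v w i j).2) hsph⟩

end Head

/-! ## §5 The head at the bridge of record ★ «D5» `Ψ_{S,v} = UnitaryGroup.localCongr … S … v` -/

section LocalCongr

variable (L : Type) [Field L] [NumberField L] [IsCMField L] (v : HeightOneSpectrum (𝓞 (Fp L)))
  (S : GL (Fin 2) L) (hS : (S : Matrix (Fin 2) (Fin 2) L) = !![1, 2⁻¹; 1, -2⁻¹])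
  (hS' : ((S⁻¹ : GL (Fin 2) L) : Matrix (Fin 2) (Fin 2) L) = !![2⁻¹, 2⁻¹; 1, -1])
  {J : Matrix (Fin 2) (Fin 2) L}
  (hc : formCongr (IsCMField.complexConj L : L →+* L) S
    (@HSMul.hSMul L (Matrix (Fin 2) (Fin 2) L) (Matrix (Fin 2) (Fin 2) L) instHSMul (1 : L) (hermD L (Equiv.prodUnique (Fin 1) (Fin 1)) (fun _ => (1 : L)) (fun _ => map_one _) (fun _ => (1 : L)) (fun _ => map_one _))) = J)

include hS hS' in
/-- **THE HEAD AT THE BRIDGE OF RECORD: `J_v = J_v(1) · Λ^{line}_{σ,v} ∘ Ψ_{S,v}`**, `Ψ_{S,v} = ★ UnitaryGroup.localCongr … S … v` — a right-`U(J)(𝒪_v)`-invariant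
local Borel section at a good place (`|2|_w = 1`, `χ` unramified above `v`) is `J_v(1) · Λ_{σ,v} ∘ Ψ_{S,v}` (§4 `apply_eq_apply_one_mul_lambdaLoc_apply` at
`κ := Ψ_{S,v}`, `hκ := localCongr_apply_eq_conj`). [cite: Casselman1980, §3] [cite: Tan1999, §1] [cite: MoeglinWaldspurger1995, II.1.7] -/
theorem apply_eq_apply_one_mul_lambdaLoc_localCongr (χ : HeckeCharacter L) (σ : ℂ)
    (hχ : ∀ w : UnitaryGroup.PlacesOver L v, χ.IsUnramifiedAt w.1)
    (h2 : ∀ w : UnitaryGroup.PlacesOver L v, ValuativeRel.valuation (w.1.adicCompletion L) (2 : w.1.adicCompletion L) = 1)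
    {Jv : UnitaryGroup.localPi L (IsCMField.complexConj L) 2 J v → ℂ}
    (hlaw : ∀ (b g : UnitaryGroup.localPi L (IsCMField.complexConj L) 2 J v) (u : ∀ w : UnitaryGroup.PlacesOver L v, (w.1.adicCompletion L)ˣ),
      (∀ w : UnitaryGroup.PlacesOver L v,
        (((b : UnitaryGroup.LocalGLPi L 2 v) w : GL (Fin 2) (w.1.adicCompletion L)) : Matrix (Fin 2) (Fin 2) (w.1.adicCompletion L)) 1 0 = 0) →
      (∀ w : UnitaryGroup.PlacesOver L v, (u w : w.1.adicCompletion L) =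
        (((b : UnitaryGroup.LocalGLPi L 2 v) w : GL (Fin 2) (w.1.adicCompletion L)) : Matrix (Fin 2) (Fin 2) (w.1.adicCompletion L)) 0 0) →
        Jv (b * g) = (∏ w : UnitaryGroup.PlacesOver L v, ((χ.localComponent w.1 (u w) : ℂˣ) : ℂ)) *
          (((∏ w : UnitaryGroup.PlacesOver L v, ‖(u w : w.1.adicCompletion L)‖ : ℝ) : ℂ) ^ (σ + 1 / 2)) * Jv g)
    (hK : ∀ k ∈ UnitaryGroup.localInt L (IsCMField.complexConj L) 2 J v, ∀ g : UnitaryGroup.localPi L (IsCMField.complexConj L) 2 J v, Jv (g * k) = Jv g)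
    (x : UnitaryGroup.localPi L (IsCMField.complexConj L) 2 J v) :
    Jv x = Jv 1 * LambdaLoc L (Equiv.prodUnique (Fin 1) (Fin 1)) (fun _ => (1 : L)) (fun _ => map_one _) (fun _ => (1 : L)) (fun _ => map_one _) v χ σ
      ((UnitaryGroup.localCongr L (IsCMField.complexConj L) S one_ne_zero hc v :) x : UnitaryGroup.localPi L (IsCMField.complexConj L) (1 + 1)
      (hermD L (Equiv.prodUnique (Fin 1) (Fin 1)) (fun _ => (1 : L)) (fun _ => map_one _) (fun _ => (1 : L)) (fun _ => map_one _)) v) :=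
  apply_eq_apply_one_mul_lambdaLoc_apply L v S hS hS' (UnitaryGroup.localCongr L (IsCMField.complexConj L) S one_ne_zero hc v :)
    (localCongr_apply_eq_conj L v S hc) χ σ hlaw hK hχ h2 x

end LocalCongr

end Summit.HodgeConjecture.HodgeConjecture.Cruxes.HLiu418.K2LiuKlingenInnerSectionSpherical

end
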